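import Literature.Computability.Cryptography.QubitRegister
import HarnessLib

/-!
# The Hadamard gate is unitary — discharged fact

Proof of the named fact `Literature.Computability.Cryptography.hGate_mem_unitaryGroup` stated in
`Literature.Computability.Cryptography.QubitRegister` (kept in a sibling file so that the
statement file stays a definitions/named-facts file):

* `hGate_mem_unitaryGroup_holds` discharges `hGate_mem_unitaryGroup`: the Hadamard gate
  `H = (1/√2) [[1, 1], [1, -1]]`, as the matrix `hGate : Matrix (QReg 1) (QReg 1) ℂ` indexed by
  one-qubit basis labels `QReg 1 = (Fin 1 → Bool)`, lies in the unitary group.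

The proof is the direct `2 × 2` computation `H H† = I`: a one-qubit label is determined by its
single bit, so the entry sum in `(H H†) x y` is a two-term sum over `Bool`; each diagonal entry
is `1/2 + 1/2 = 1` and each off-diagonal entry is `1/2 - 1/2 = 0`.

## References

* M. A. Nielsen, I. L. Chuang, *Quantum Computation and Quantum Information*, 10th anniversary
  ed., CUP 2010, §2.2.2, eq. (2.85) (the Hadamard gate `H = (1/√2) [[1, 1], [1, -1]]`, "another
  interesting unitary operator") and Exercise 2.51 ("Verify that the Hadamard gate `H` is
  unitary"), book p. 127 [NielsenChuang2010].
-/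

namespace Literature.Computability.Cryptography

open Matrix

/-- **Discharge of `hGate_mem_unitaryGroup`.** The Hadamard gate `H = (1/√2) [[1, 1], [1, -1]]` is
unitary: `H H† = I` by direct computation of the four entries over the two-element index type
`QReg 1 = (Fin 1 → Bool) ≃ Bool` (each diagonal entry is `1/2 + 1/2`, each off-diagonal entry is
`1/2 - 1/2`). Nielsen–Chuang introduce `H` as "another interesting unitary operator", eq. (2.85),
and leave unitarity as Exercise 2.51 (§2.2.2, book p. 127).
[cite: NielsenChuang2010, §2.2.2 eq. (2.85), Exercise 2.51] -/
theorem hGate_mem_unitaryGroup_holds : hGate_mem_unitaryGroup := by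
  unfold hGate_mem_unitaryGroup
  rw [Matrix.mem_unitaryGroup_iff]
  -- a one-qubit register is determined by its single bit
  have key : ∀ z : QReg 1, z = fun _ => z 0 := fun z => funext fun i => by
    rw [Subsingleton.elim i 0]
  have h2 : ((Real.sqrt 2 : ℂ))⁻¹ * ((Real.sqrt 2 : ℂ))⁻¹ = 1 / 2 := by
    rw [← mul_inv, ← Complex.ofReal_mul, Real.mul_self_sqrt zero_le_two]
    norm_num
  ext x y
  obtain ⟨a, rfl⟩ : ∃ a : Bool, x = fun _ => a := ⟨x 0, key x⟩
  obtain ⟨b, rfl⟩ : ∃ b : Bool, y = fun _ => b := ⟨y 0, key y⟩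
  -- expand the `(a, b)` entry of `H H†` as a two-term sum over the middle bit
  rw [Matrix.mul_apply, Fintype.sum_equiv (Equiv.funUnique (Fin 1) Bool)
    (fun j => hGate (fun _ => a) j * star hGate j (fun _ => b))
    (fun c => hGate (fun _ => a) (fun _ => c) * star hGate (fun _ => c) (fun _ => b))
    (fun j => by rw [key j]; rfl), Fintype.sum_bool, Matrix.one_apply]
  have hab : ((fun _ => a : QReg 1) = fun _ => b) ↔ a = b :=
    ⟨fun h => congrFun h 0, fun h => h ▸ rfl⟩
  simp only [hGate, Matrix.star_apply, Matrix.of_apply, hab]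
  cases a <;> cases b <;> simp [h2] <;> norm_num

end Literature.Computability.Cryptography
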